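import Mathlib.Data.Fintype.Fin
import Literature.Topology.FourManifolds.MorseChartChangeInterior
import Literature.Topology.FourManifolds.GradientLikeExistence
import HarnessLib

/-!
# The index of a Milnor chart is the Morse index

Topic `Literature/Topology/FourManifolds` (fact seat
`provefact-Literature.SPC4.exists_isMorse_isSelfIndexing`).  Milnor, *Lectures on the h-cobordism
theorem* (1965), Def. 3.1, condition 2): about each critical point `p` of `f` there are
coordinates `(x₁, …, x_λ, x_{λ+1}, …, xₙ)` with `f = f(p) - |x⃗|² + |y⃗|²` and
`ξ = (-x⃗, y⃗)`; there `λ` is the index of `p`.  The tree's `Literature.Topology.FourManifolds.IsGradientLike`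
(`GradientLike.lean`) quantifies this `λ = k` existentially ("forced by the normal form of
`f`").  This file **proves** that it is forced: if a `C²` function has the form
`f q = f p + Q_k(φ q - φ p)` on a chart `φ` of the maximal atlas about an interior point `p`,
then `p` is a critical point of Morse index `min m k`
(`Literature.Topology.FourManifolds.isMCriticalPt_and_morseIndex_eq_of_eq_milnorQuadratic`; Milnor 1963, §2: the index is
the negative index of inertia of the Hessian in any coordinate system — the chart-change
theorem at interior points is `MorseChartChangeInterior.lean`; the Hessian of `Q_k` is the
diagonal form `Σ 2εᵢ vᵢ wᵢ`, `Literature.Topology.FourManifolds.milnorHessian`, whose negative index of inertia is the number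
`min m k` of negative signs by Sylvester's law, Mathlib's
`QuadraticForm.sigNeg_of_equiv_weightedSumSquares`), and consequently a gradient-like field
admits about each interior critical point a Milnor chart *with `k` the Morse index*
(`Literature.Topology.FourManifolds.IsGradientLike.exists_chart_morseIndex`).

## References

* J. Milnor, *Lectures on the h-cobordism theorem* (1965), Def. 3.1 (PDF pp. 11–12). [MilnorHCobordism1965]
* J. Milnor, *Morse theory* (1963), §2. [Milnor1963]
-/

open scoped Manifold ContDiff Topology
open Set Function Filter

noncomputable section

namespace Literature.Topology.FourManifolds

/-! ### The Hessian of Milnor's quadratic form -/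

section Model

variable {m : ℕ}

/-- Local notation: `𝔼 n` is the model Euclidean space `EuclideanSpace ℝ (Fin n)`. -/
local notation "𝔼 " n:arg => EuclideanSpace ℝ (Fin n)

/-- The sign `εᵢ = -1` (`i < k`) or `+1` (`i ≥ k`) of Milnor's quadratic form. [cite: MilnorHCobordism1965, Def. 3.1] -/
def milnorSign (k : ℕ) (i : Fin m) : ℝ := if (i : ℕ) < k then -1 else 1

/-- Unfolding `milnorSign`. [folklore] -/
theorem milnorSign_apply (k : ℕ) (i : Fin m) : milnorSign k i = if (i : ℕ) < k then -1 else 1 := rfl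

/-- `εᵢ < 0` iff `i < k`. [folklore] -/
theorem milnorSign_neg_iff (k : ℕ) (i : Fin m) : milnorSign k i < 0 ↔ (i : ℕ) < k := by
  unfold milnorSign; split_ifs with h <;> simp [h]

/-- **The Hessian of Milnor's quadratic form** `-(u₁² + ⋯ + u_k²) + (u_{k+1}² + ⋯ + uₘ²)`: the
(constant) symmetric bilinear map `(v, w) ↦ Σᵢ 2 εᵢ vᵢ wᵢ`, as a continuous bilinear map. [folklore] -/
def milnorHessian (k : ℕ) : 𝔼 m →L[ℝ] 𝔼 m →L[ℝ] ℝ :=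
  ∑ i : Fin m, (2 * milnorSign k i) •
    (EuclideanSpace.proj (𝕜 := ℝ) i).smulRight (EuclideanSpace.proj (𝕜 := ℝ) i)

/-- `milnorHessian k v w = Σᵢ 2 εᵢ vᵢ wᵢ`. [folklore] -/
theorem milnorHessian_apply_apply (k : ℕ) (v w : 𝔼 m) :
    milnorHessian k v w = ∑ i : Fin m, 2 * milnorSign k i * (v i * w i) := by
  simp only [milnorHessian, FunLike.coe_sum, Finset.sum_apply,
    FunLike.coe_smul, Pi.smul_apply, ContinuousLinearMap.smulRight_apply,
    EuclideanSpace.coe_proj, smul_eq_mul]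


/-- The derivative of Milnor's quadratic form is `u ↦ milnorHessian k u`. [folklore] -/
theorem fderiv_milnorQuadratic (k : ℕ) (u : 𝔼 m) :
    fderiv ℝ (milnorQuadratic (m := m) k) u = milnorHessian k u := by
  rw [(hasFDerivAt_milnorQuadratic k u).fderiv]
  ext w
  simp only [FunLike.coe_sum, Finset.sum_apply, FunLike.coe_smul,
    Pi.smul_apply, EuclideanSpace.coe_proj, smul_eq_mul, milnorHessian_apply_apply, milnorSign]
  refine Finset.sum_congr rfl fun i _ => ?_
  ring

/-- The second derivative of Milnor's quadratic form is the constant `milnorHessian k`. [folklore] -/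
theorem fderiv_fderiv_milnorQuadratic (k : ℕ) (u : 𝔼 m) :
    fderiv ℝ (fderiv ℝ (milnorQuadratic (m := m) k)) u = milnorHessian k := by
  have h : fderiv ℝ (milnorQuadratic (m := m) k) = fun u => milnorHessian k u :=
    funext (fderiv_milnorQuadratic k)
  rw [h]
  exact (milnorHessian (m := m) k).fderiv

/-- The derivative of the re-centred, shifted form `v ↦ c + Q_k(v - u₀)`. [folklore] -/
theorem hasFDerivAt_const_add_milnorQuadratic_sub (c : ℝ) (k : ℕ) (u₀ v : 𝔼 m) :
    HasFDerivAt (fun v : 𝔼 m => c + milnorQuadratic k (v - u₀)) (milnorHessian k (v - u₀)) v := by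
  have hT : HasFDerivAt (fun x : 𝔼 m => x - u₀) (ContinuousLinearMap.id ℝ (𝔼 m)) v :=
    (hasFDerivAt_id v).sub_const u₀
  have h1 : HasFDerivAt (milnorQuadratic (m := m) k ∘ fun x : 𝔼 m => x - u₀)
      ((∑ i : Fin m, ((if (i : ℕ) < k then -1 else 1) * (2 * (v - u₀) i)) •
        (EuclideanSpace.proj (𝕜 := ℝ) i)).comp (ContinuousLinearMap.id ℝ (𝔼 m))) v :=
    (hasFDerivAt_milnorQuadratic k (v - u₀)).comp v hT
  have h : HasFDerivAt (fun x : 𝔼 m => c + milnorQuadratic k (x - u₀))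
      ((∑ i : Fin m, ((if (i : ℕ) < k then -1 else 1) * (2 * (v - u₀) i)) •
        (EuclideanSpace.proj (𝕜 := ℝ) i)).comp (ContinuousLinearMap.id ℝ (𝔼 m))) v :=
    h1.const_add c
  refine h.congr_fderiv ?_
  rw [ContinuousLinearMap.comp_id, ← (hasFDerivAt_milnorQuadratic k (v - u₀)).fderiv,
    fderiv_milnorQuadratic]

/-- The derivative of `v ↦ c + Q_k(v - u₀)` as a function. [folklore] -/
theorem fderiv_const_add_milnorQuadratic_sub (c : ℝ) (k : ℕ) (u₀ : 𝔼 m) :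
    fderiv ℝ (fun v : 𝔼 m => c + milnorQuadratic k (v - u₀)) = fun v => milnorHessian k (v - u₀) :=
  funext fun v => (hasFDerivAt_const_add_milnorQuadratic_sub c k u₀ v).fderiv

/-- The second derivative of the re-centred, shifted form `u ↦ c + Q_k(u - u₀)` at any point is
`milnorHessian k`. [folklore] -/
theorem fderiv_fderiv_const_add_milnorQuadratic_sub (c : ℝ) (k : ℕ) (u₀ u : 𝔼 m) :
    fderiv ℝ (fderiv ℝ fun v : 𝔼 m => c + milnorQuadratic k (v - u₀)) u = milnorHessian k := by
  rw [fderiv_const_add_milnorQuadratic_sub]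
  have hT : HasFDerivAt (fun x : 𝔼 m => x - u₀) (ContinuousLinearMap.id ℝ (𝔼 m)) u :=
    (hasFDerivAt_id u).sub_const u₀
  have h2 : HasFDerivAt (fun v : 𝔼 m => milnorHessian k (v - u₀))
      ((milnorHessian (m := m) k).comp (ContinuousLinearMap.id ℝ (𝔼 m))) u :=
    (milnorHessian (m := m) k).hasFDerivAt.comp u hT
  rw [h2.fderiv, ContinuousLinearMap.comp_id]

/-- `milnorHessian k` vanishes on the zero vector (the origin is a critical point of `Q_k`). [folklore] -/
theorem milnorHessian_zero (k : ℕ) : milnorHessian (m := m) k 0 = 0 := map_zero _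

/-- The Hessian of Milnor's quadratic form as a bilinear form on `ℝᵐ` (the shape of
`Literature.Topology.FourManifolds.hessianInChart`). [folklore] -/
def milnorHessianBilin (k : ℕ) : LinearMap.BilinForm ℝ (𝔼 m) :=
  (ContinuousLinearMap.coeLM ℝ).comp (milnorHessian (m := m) k).toLinearMap

/-- Unfolding `milnorHessianBilin`. [folklore] -/
theorem milnorHessianBilin_apply_apply (k : ℕ) (v w : 𝔼 m) :
    milnorHessianBilin k v w = milnorHessian k v w := rfl

/-- **Sylvester count**: the negative index of inertia of `v ↦ Σᵢ 2 εᵢ vᵢ²` is the number of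
negative signs, `min m k`. [folklore] -/
theorem sigNeg_milnorHessianBilin (k : ℕ) :
    sigNeg (milnorHessianBilin (m := m) k).toQuadraticMap = min m k := by
  classical
  set w : Fin m → ℝ := fun i => 2 * milnorSign k i with hw
  have hequiv : (milnorHessianBilin (m := m) k).toQuadraticMap.Equivalent
      (QuadraticMap.weightedSumSquares ℝ w) := by
    refine ⟨⟨WithLp.linearEquiv 2 ℝ (Fin m → ℝ), fun v => ?_⟩⟩
    rw [QuadraticMap.weightedSumSquares_apply, LinearMap.BilinMap.toQuadraticMap_apply,
      milnorHessianBilin_apply_apply, milnorHessian_apply_apply]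
    refine Finset.sum_congr rfl fun i _ => ?_
    simp only [hw, smul_eq_mul]
    rfl
  rw [QuadraticForm.sigNeg_of_equiv_weightedSumSquares hequiv]
  have hset : {i : Fin m | w i < 0} = ((Finset.univ : Finset (Fin m)).filter fun i => (i : ℕ) < k : Finset (Fin m)) := by
    ext i
    simp only [hw, mem_setOf_eq, Finset.coe_filter, Finset.mem_univ, true_and]
    rw [mul_neg_iff, milnorSign_neg_iff]
    constructor
    · rintro (⟨-, h⟩ | ⟨h, -⟩)
      · exact h
      · linarith
    · exact fun h => Or.inl ⟨two_pos, h⟩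
  rw [hset, Set.ncard_coe_finset, Fin.card_filter_val_lt]

end Model

/-! ### The index of a chart in Milnor's normal form -/

section Manifold

variable {m : ℕ} {H : Type*} [TopologicalSpace H] {J : ModelWithCorners ℝ (EuclideanSpace ℝ (Fin m)) H}
  {M : Type*} [TopologicalSpace M] [ChartedSpace H M] [IsManifold J ∞ M]

/-- **The `k` of a Milnor chart is the Morse index** (Milnor 1965, Def. 3.1: the coordinates
`(x₁, …, x_λ, x_{λ+1}, …, xₙ)` with `f = f(p) - |x⃗|² + |y⃗|²` have `λ = index(p)`; Milnor 1963,
§2: the index is the negative index of inertia of the Hessian in any coordinate system).  If a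
`C²` function `f` has the form `f q = f p + Q_k(φ q - φ p)` on the domain of a chart `φ` of the
maximal atlas about an interior point `p`, then `p` is a critical point of `f` of Morse index
`min m k` (`= k` for `k ≤ m = dim M`). [cite: MilnorHCobordism1965, Def. 3.1] [cite: Milnor1963, §2] -/
theorem isMCriticalPt_and_morseIndex_eq_of_eq_milnorQuadratic {f : M → ℝ} {p : M}
    (hf : ContMDiffAt J 𝓘(ℝ, ℝ) 2 f p) {φ : OpenPartialHomeomorph M H}
    (hφ : φ ∈ IsManifold.maximalAtlas J ∞ M) (hp : p ∈ φ.source) (hpint : J.IsInteriorPoint p) {k : ℕ}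
    (hfq : ∀ q ∈ φ.source, f q = f p + milnorQuadratic k (φ.extend J q - φ.extend J p)) :
    IsMCriticalPt J f p ∧ morseIndex J f p = min m k := by
  haveI : IsManifold J 2 M := IsManifold.of_le (n := ∞) (by norm_cast)
  have hφ2 : φ ∈ IsManifold.maximalAtlas J 2 M :=
    IsManifold.maximalAtlas_subset_of_le (I := J) (M := M) (by norm_cast) hφ
  have hφ1 : φ ∈ IsManifold.maximalAtlas J 1 M :=
    IsManifold.maximalAtlas_subset_of_le (I := J) (M := M) (by norm_cast) hφ
  set u₀ := φ.extend J p with hu₀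
  set F : EuclideanSpace ℝ (Fin m) → ℝ := fun v => f p + milnorQuadratic k (v - u₀) with hF
  -- near `u₀`, `f` read in the chart `φ` is `F`
  have htarget : (φ.extend J).target ∈ 𝓝 u₀ := by
    have h := φ.extend_target_mem_nhdsWithin (I := J) hp
    rwa [nhdsWithin_eq_nhds.2 (range_mem_nhds_extend_of_isInteriorPoint one_ne_zero hφ1 hp hpint)] at h
  have heq : f ∘ (φ.extend J).symm =ᶠ[𝓝 u₀] F := by
    filter_upwards [htarget] with u hu
    have hsrc : (φ.extend J).symm u ∈ φ.source := by
      rw [← φ.extend_source (I := J)]; exact (φ.extend J).map_target hu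
    simp only [comp_apply, hF]
    rw [hfq _ hsrc, (φ.extend J).right_inv hu]
  -- critical point
  have hcrit : IsMCriticalPt J f p := by
    rw [isMCriticalPt_iff_fderiv_comp_extend_symm_eq_zero_of_isInteriorPoint hf hφ2 hp hpint,
      heq.fderiv_eq, hF, fderiv_const_add_milnorQuadratic_sub]
    show milnorHessian k (u₀ - u₀) = 0
    rw [sub_self, milnorHessian_zero]
  refine ⟨hcrit, ?_⟩
  rw [morseIndex_eq_sigNeg_hessianInChart_of_isInteriorPoint hf hcrit hφ2 hp hpint]
  have hH : hessianInChart J φ f p = milnorHessianBilin k := by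
    ext v w
    rw [hessianInChart_apply_eq_fderiv_fderiv_of_isInteriorPoint hφ1 hp hpint,
      (heq.fderiv).fderiv_eq, hF, fderiv_fderiv_const_add_milnorQuadratic_sub]
    rfl
  rw [hH, sigNeg_milnorHessianBilin]

/-- For a gradient-like vector field, the index `k` of Milnor's normal form about an interior
critical point of a `C²` function is the Morse index (`min m k`, i.e. `k` when `k ≤ m`). [cite: MilnorHCobordism1965, Def. 3.1] -/
theorem IsGradientLike.exists_chart_morseIndex {f : M → ℝ} {ξ : Π x : M, TangentSpace J x}
    (hgl : IsGradientLike J f ξ) (hf : ContMDiff J 𝓘(ℝ, ℝ) 2 f) {p : M}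
    (hp : IsMCriticalPt J f p) (hpint : J.IsInteriorPoint p) :
    ∃ φ ∈ IsManifold.maximalAtlas J ∞ M, p ∈ φ.source ∧
      (∀ q ∈ φ.source, f q = f p + milnorQuadratic (morseIndex J f p) (φ.extend J q - φ.extend J p)) ∧
      (∀ q ∈ φ.source, mfderiv J 𝓘(ℝ, EuclideanSpace ℝ (Fin m)) (φ.extend J) q (ξ q) =
        milnorModelField (morseIndex J f p) (φ.extend J q - φ.extend J p)) := by
  obtain ⟨φ, hφ, k, hpφ, hfq, hξq⟩ := hgl.exists_chart p hp
  have hidx : morseIndex J f p = min m k :=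
    (isMCriticalPt_and_morseIndex_eq_of_eq_milnorQuadratic (hf p) hφ hpφ hpint hfq).2
  -- `Q_k` and the model field only see `min m k`
  have hQ : ∀ u : EuclideanSpace ℝ (Fin m), milnorQuadratic k u = milnorQuadratic (min m k) u := by
    intro u
    rw [milnorQuadratic_eq_sum, milnorQuadratic_eq_sum]
    refine Finset.sum_congr rfl fun i _ => ?_
    have hi : ((i : ℕ) < k) ↔ ((i : ℕ) < min m k) := by
      simp only [lt_min_iff, i.isLt, true_and]
    simp only [hi]
  have hV : ∀ u : EuclideanSpace ℝ (Fin m), milnorModelField k u = milnorModelField (min m k) u := by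
    intro u
    ext i
    have hi : ((i : ℕ) < k) ↔ ((i : ℕ) < min m k) := by
      simp only [lt_min_iff, i.isLt, true_and]
    simp only [milnorModelField_apply, hi]
  refine ⟨φ, hφ, hpφ, fun q hq => ?_, fun q hq => ?_⟩
  · rw [hidx, ← hQ]; exact hfq q hq
  · rw [hidx, ← hV]; exact hξq q hq

end Manifold

end Literature.Topology.FourManifolds
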